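import Summits.Ventures.GridStability.Lyapunov.WSCC9LossySlabLPDualData
import Summits.Ventures.GridStability.Lyapunov.WSCC9LossySlabDual33
import Literature.MathematicalPhysics.PowerSystems.LuriePostnikovSlabPositivityDual
import HarnessLib

/-!
# «#74-LP» — the Lur'e–Postnikov POSITIVITY class on the lossy 9-bus is EMPTY from `2·arctan(67/1000)` on
# (file 2 of 2: the LP dual witness over `ℝ` and the theorem)

**OBSTRUCTION row beside ★ #35 / ★ #74 / «#74′» for the WIDER class** `LPSlabCertificate` (coercivity
`P + Cᵀ·diag(λa)·C − ε·1 ⪰ 0`, `P` free; ⊇ the class of record by `SlabCertificate.toLP`) on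
`M′ = WSCC9.lurieSystem` (lane V's object, `Models/ClassicalSwingLurie.lean`) at the window
`γ₀ = 2·arctan(67/1000)` (≈ 7.666°): `D : LPSlabDualWitness WSCC9.lurieSystem a0 b0` (lit-6's receptacle
`LuriePostnikovSlabPositivityDual.lean`: `Z ⪰ 0`, (D1) `W + Wᵀ ⪰ 0` for the TRUE irrational input matrix
via the centre form on lane V's weight box, (D2), (D3′) `a0_k·q_k ≤ 2 s_k`, (D4)), every field from the
kernel decisions of file 1 by cast identities; `no_lpSlabCertificate_at` / `no_lpSlabCertificate` /
`lpSlabClass_empty` / `no_lpSlabCertificate_perChannel` — **no** `Λ : LPSlabCertificate WSCC9.lurieSystem`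
satisfies the sector hypothesis `hsec` of `LPSlabCertificate.well_subset_regionOfAttraction` for any window
(function) `≥ γ₀` (on the six active channels); `no_slabCertificate_of_lp` — the class of record as the
special case; `lpClassCeiling_bracket` — the positivity class is NON-EMPTY at ★ #35's `2·arctan(13/200)`
(`cert.toLP`) and EMPTY from `2·arctan(67/1000)`; `γ₀_dual33_lt_γ₀` / `γ₀_lt_dual74` place the window
between «#74′» (7.552°) and ★ #74 (8.008°).

THREE COLUMNS.  CERTIFIED: «no certificate of the WIDER typed class (`LPSlabCertificate` + `hsec`)
certifies a slab half-width `≥ 2·arctan(67/1000)` for `M′`; the loop-transformation / positivity lever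
(×220 in LEVEL on ★ #45, ×60 on «#35‴») does NOT move the lossy WINDOW ceiling beyond it».  VALIDATED
(floats, lit-6 kit j285467): both classes' dual margins change sign between `u = 33/500` and `67/1000`,
both box-centre primal margins between `13/200` and `33/500` — at most ≈ 0.1° of window.  MODELLED: as
#35 (object identity = lane V's `A_eq`, `C_eq`, `hB`, `hw`, by name).  The sentence is about the
CERTIFICATE CLASS, not about the region of attraction of `M′` or of any grid.
[cite: BoydVandenberghe2004, §5.9.4 (5.97)–(5.98), Example 5.14; Khalil2002, §7.1 Example 7.5, §7.1.2 Theorem 7.3; Pai1981, §2.16 (2.63)–(2.64), §4.6 p. 117]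
-/

noncomputable section

open Real Matrix
open Literature.Computation.Certificates
open Literature.MathematicalPhysics.PowerSystems
open Literature.MathematicalPhysics.PowerSystems.LyapunovFunctionFamily
open Summit.Ventures.GridStability.Models
open Summit.Ventures.GridStability.Lyapunov.WSCC9LossySlab

namespace Summit.Ventures.GridStability.Lyapunov.WSCC9LossySlabLPDual

/-! ### Cast plumbing (the parent files' copies are private) -/

/-- `(M + N) ↦ ℝ` (cast plumbing). -/ private theorem map_add' {m n : Type*} (M N : Matrix m n ℚ) :
    (M + N).map (Rat.cast : ℚ → ℝ) = M.map (Rat.cast : ℚ → ℝ) + N.map (Rat.cast : ℚ → ℝ) := by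
  ext i k; simp
/-- `(M − N) ↦ ℝ` (cast plumbing). -/ private theorem map_sub' {m n : Type*} (M N : Matrix m n ℚ) :
    (M - N).map (Rat.cast : ℚ → ℝ) = M.map (Rat.cast : ℚ → ℝ) - N.map (Rat.cast : ℚ → ℝ) := by
  ext i k; simp
/-- `(−M) ↦ ℝ` (cast plumbing). -/ private theorem map_neg' {m n : Type*} (M : Matrix m n ℚ) :
    (-M).map (Rat.cast : ℚ → ℝ) = -M.map (Rat.cast : ℚ → ℝ) := by
  ext i k; simp
/-- `(q • M) ↦ ℝ` (cast plumbing). -/ private theorem map_smul' {m n : Type*} (q : ℚ) (M : Matrix m n ℚ) :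
    (q • M).map (Rat.cast : ℚ → ℝ) = ((q : ℚ) : ℝ) • M.map (Rat.cast : ℚ → ℝ) := by
  ext i k; simp
/-- `(Σ_j M_j) ↦ ℝ` (cast plumbing). -/ private theorem map_sum' {m n : Type*} {J : Type*} (s : Finset J) (M : J → Matrix m n ℚ) :
    (∑ j ∈ s, M j).map (Rat.cast : ℚ → ℝ) = ∑ j ∈ s, (M j).map (Rat.cast : ℚ → ℝ) := by
  ext i k; simp [Matrix.sum_apply]
/-- `(M N) ↦ ℝ` (cast plumbing). -/ private theorem map_mul' {l m n : Type*} [Fintype m] (M : Matrix l m ℚ) (N : Matrix m n ℚ) :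
    (M * N).map (Rat.cast : ℚ → ℝ) = M.map (Rat.cast : ℚ → ℝ) * N.map (Rat.cast : ℚ → ℝ) := by
  ext i k; simp [Matrix.mul_apply]
/-- `Mᵀ ↦ ℝ` (cast plumbing). -/ private theorem map_transpose' {m n : Type*} (M : Matrix m n ℚ) :
    Mᵀ.map (Rat.cast : ℚ → ℝ) = (M.map (Rat.cast : ℚ → ℝ))ᵀ := by
  ext i k; simp

/-! ### The LP witness data over `ℝ` -/

/-- `Z₁₁ ↦ ℝ`. -/
def Z₁₁ : Matrix (Fin 3 ⊕ Fin 2) (Fin 3 ⊕ Fin 2) ℝ := Z11Q.map (Rat.cast : ℚ → ℝ)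
/-- `Z₂₁ ↦ ℝ`. -/
def Z₂₁ : Matrix (Fin 3 × Fin 3) (Fin 3 ⊕ Fin 2) ℝ := Z21Q.map (Rat.cast : ℚ → ℝ)
/-- `Z₂₂ ↦ ℝ`. -/
def Z₂₂ : Matrix (Fin 3 × Fin 3) (Fin 3 × Fin 3) ℝ := Z22Q.map (Rat.cast : ℚ → ℝ)
/-- The LP witness's INNER lower slopes over `ℝ`. -/
def a0 (k : Fin 3 × Fin 3) : ℝ := (a0K k : ℝ)
/-- The LP witness's INNER upper slopes over `ℝ`. -/
def b0 (k : Fin 3 × Fin 3) : ℝ := (b0K k : ℝ)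
/-- The window `γ₀ = 2·arctan(67/1000)` (≈ 7.666°). -/
def γ₀ : ℝ := 2 * Real.arctan ((u0Q : ℚ) : ℝ)

/-- `γ₀` is the literal window `2·arctan(67/1000)` of the row's name. -/
theorem γ₀_eq : γ₀ = 2 * Real.arctan (67 / 1000) := by
  unfold γ₀; norm_num [u0Q]

/-- `cos γ₀ = cg0Q` (cast form, feeds `hwin`). -/
private theorem cos_γ₀_cast : Real.cos γ₀ = ((cg0Q : ℚ) : ℝ) := by
  unfold γ₀ cg0Q
  rw [Lyapunov.StructurePreserving.cos_two_mul_arctan]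
  push_cast
  ring

/-- `sin γ₀ = sg0Q` (cast form, feeds `hwin`). -/
private theorem sin_γ₀_cast : Real.sin γ₀ = ((sg0Q : ℚ) : ℝ) := by
  unfold γ₀ sg0Q
  rw [Lyapunov.StructurePreserving.sin_two_mul_arctan]
  push_cast
  ring

/-- `0 ≤ γ₀ ≤ π/2`. -/
theorem γ₀_range : 0 ≤ γ₀ ∧ γ₀ ≤ π / 2 := by
  have hu : (0 : ℝ) ≤ ((u0Q : ℚ) : ℝ) := by exact_mod_cast u0Q_pos_lt.1.le
  have hu1 : ((u0Q : ℚ) : ℝ) < 1 := by exact_mod_cast u0Q_pos_lt.2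
  exact ⟨Lyapunov.StructurePreserving.two_mul_arctan_nonneg hu,
    (Lyapunov.StructurePreserving.two_mul_arctan_lt_pi_div_two hu1).le⟩

/-! ### `Z ⪰ 0` over `ℝ` -/

/-- The receptacle's block matrix is `ZQ ↦ ℝ`. -/
theorem fromBlocks_eq : Matrix.fromBlocks Z₁₁ Z₂₁ᵀ Z₂₁ Z₂₂ = ZQ.map (Rat.cast : ℚ → ℝ) := by
  rw [ZQ, Matrix.fromBlocks_map, Z₁₁, Z₂₁, Z₂₂, map_transpose']

/-- **`Z ⪰ 0`.** -/
theorem psd : (Matrix.fromBlocks Z₁₁ Z₂₁ᵀ Z₂₁ Z₂₂).PosSemidef := by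
  rw [fromBlocks_eq]
  have h := (ZQ_ldl.posSemidef (R := ℝ)).submatrix e2
  have e : ((ZQ.submatrix ⇑e2.symm ⇑e2.symm).map (Rat.cast : ℚ → ℝ)).submatrix e2 e2
      = ZQ.map (Rat.cast : ℚ → ℝ) := by
    ext i j; simp
  rwa [e] at h

/-! ### (D1): `W + Wᵀ ⪰ 0` for the TRUE input matrix, by the centre form on lane V's weight box -/

/-- `G₀ ↦ ℝ`, `G_j ↦ ℝ`. -/
def G₀ : Matrix (Fin 3 ⊕ Fin 2) (Fin 3 ⊕ Fin 2) ℝ := G0Q.map (Rat.cast : ℚ → ℝ)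
/-- `G_j ↦ ℝ`. -/
def G (j : Fin 6) : Matrix (Fin 3 ⊕ Fin 2) (Fin 3 ⊕ Fin 2) ℝ := (GjQ j).map (Rat.cast : ℚ → ℝ)

/-- `G_j` is symmetric. -/
theorem G_isHermitian (j : Fin 6) : (G j).IsHermitian := by
  show (G j)ᴴ = G j
  rw [Matrix.conjTranspose_eq_transpose_of_trivial, G, ← map_transpose', GjQ_transpose]

/-- **The affine decomposition of `W + Wᵀ` in the weights**:
`dualAdjP M′ Z₁₁ Z₂₁ + (·)ᵀ = G₀ + Σ_j w_j • G_j` (from lane V's `A_eq`, `hB`, `Bj_eq`). -/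
theorem adj_eq : dualAdjP WSCC9.lurieSystem Z₁₁ Z₂₁ + (dualAdjP WSCC9.lurieSystem Z₁₁ Z₂₁)ᵀ
    = G₀ + ∑ j, w j • G j := by
  have hBZ : WSCC9.lurieSystem.B * Z₂₁ = ∑ j, w j • (Bj j * Z₂₁) := by
    rw [hB, zero_add, Matrix.sum_mul]
    exact Finset.sum_congr rfl fun j _ => Matrix.smul_mul _ _ _
  have hX : Z₁₁ * WSCC9.lurieSystem.Aᵀ + WSCC9.lurieSystem.A * Z₁₁
      = (Z11Q * AQᵀ + AQ * Z11Q).map (Rat.cast : ℚ → ℝ) := by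
    rw [A_eq, Z₁₁, map_add', map_mul', map_mul', map_transpose']
  have hG : ∀ j, w j • G j = -((2 : ℝ) • (w j • (Bj j * Z₂₁))) - ((2 : ℝ) • (w j • (Bj j * Z₂₁)))ᵀ := by
    intro j
    rw [G, GjQ, map_neg', map_smul', map_add', map_transpose', map_mul', ← Bj_eq, Z₂₁,
      Matrix.transpose_smul, Matrix.transpose_smul]
    simp only [smul_add, smul_neg, Rat.cast_ofNat, smul_comm (w j) (2 : ℝ)]
    abel
  rw [dualAdjP, hBZ, G₀, G0Q, map_add', map_transpose', ← hX]
  simp only [hG, Matrix.transpose_sub, Matrix.transpose_add, Matrix.transpose_smul,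
    Matrix.transpose_sum, Finset.smul_sum, Finset.sum_sub_distrib, Finset.sum_neg_distrib]
  abel

/-- The centre-form matrix over `ℝ` is `HQ ↦ ℝ`. -/
theorem center_eq : G₀ + ∑ j, ctr j • G j - ∑ j, rad j • rowAbsDiag (G j)
    = HQ.map (Rat.cast : ℚ → ℝ) := by
  rw [HQ, map_sub', map_add', map_sum', map_sum', G₀]
  congr 1
  · congr 1
    exact Finset.sum_congr rfl fun j _ => by rw [map_smul', ctr, G]
  · exact Finset.sum_congr rfl fun j _ => by rw [map_smul', rad, G, rowAbsDiag_map_ratCast]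

/-- `H ⪰ 0` over `ℝ`. -/
theorem center_psd : (G₀ + ∑ j, ctr j • G j - ∑ j, rad j • rowAbsDiag (G j)).PosSemidef := by
  rw [center_eq]
  have h := (HQ_ldl.posSemidef (R := ℝ)).submatrix e1
  have e : ((HQ.submatrix ⇑e1.symm ⇑e1.symm).map (Rat.cast : ℚ → ℝ)).submatrix e1 e1
      = HQ.map (Rat.cast : ℚ → ℝ) := by
    ext i j; simp
  rwa [e] at h

/-- **(D1)** `W + Wᵀ ⪰ 0` for the true (irrational) input matrix of `M′`. -/
theorem adjP_psd :
    (dualAdjP WSCC9.lurieSystem Z₁₁ Z₂₁ + (dualAdjP WSCC9.lurieSystem Z₁₁ Z₂₁)ᵀ).PosSemidef := by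
  rw [adj_eq]
  exact posSemidef_affine_of_center G₀ G G_isHermitian ctr rad center_psd w hw_center

/-! ### (D2), (D3′), (D4) and the null channels over `ℝ` -/

/-- The five dual functionals are the casts of `UQ`, `VQ`, `WQ`, `SQ`, `QQ` (the positivity functional
`q_k = (C·W·Cᵀ)_kk` loses its `B`-part because `C·B = 0` on the machine-reference presentation). -/
theorem functionals_eq (k : Fin 3 × Fin 3) :
    (WSCC9.lurieSystem.C * Z₁₁ * WSCC9.lurieSystem.Cᵀ) k k = ((UQ k : ℚ) : ℝ) ∧
    (Z₂₁ * WSCC9.lurieSystem.Cᵀ) k k = ((VQ k : ℚ) : ℝ) ∧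
    Z₂₂ k k = ((WQ k : ℚ) : ℝ) ∧
    dualPopovCoeff WSCC9.lurieSystem Z₂₁ Z₂₂ k = ((SQ k : ℚ) : ℝ) ∧
    dualLowerCoeff WSCC9.lurieSystem Z₁₁ Z₂₁ k = ((QQ k : ℚ) : ℝ) := by
  refine ⟨?_, ?_, ?_, ?_, ?_⟩
  · rw [C_eq, Z₁₁, ← map_transpose', ← map_mul', ← map_mul', Matrix.map_apply, UQ]
  · rw [C_eq, Z₂₁, ← map_transpose', ← map_mul', Matrix.map_apply, VQ]
  · rw [Z₂₂, Matrix.map_apply, WQ]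
  · rw [dualPopovCoeff, Matrix.mul_assoc, ← Matrix.mul_assoc WSCC9.lurieSystem.C, WSCC9LossySlabDual.C_mul_B,
      Matrix.zero_mul, Matrix.zero_apply, sub_zero, C_eq, A_eq, Z₂₁, ← map_mul', ← map_transpose',
      ← map_mul', Matrix.map_apply, SQ]
  · have hsplit : WSCC9.lurieSystem.C * dualAdjP WSCC9.lurieSystem Z₁₁ Z₂₁ * WSCC9.lurieSystem.Cᵀ
        = WSCC9.lurieSystem.C * (Z₁₁ * WSCC9.lurieSystem.Aᵀ + WSCC9.lurieSystem.A * Z₁₁)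
            * WSCC9.lurieSystem.Cᵀ := by
      rw [dualAdjP, Matrix.mul_sub, Matrix.sub_mul, Matrix.mul_smul, Matrix.smul_mul,
        ← Matrix.mul_assoc WSCC9.lurieSystem.C WSCC9.lurieSystem.B, WSCC9LossySlabDual.C_mul_B,
        Matrix.zero_mul, Matrix.zero_mul, smul_zero, sub_zero]
    rw [dualLowerCoeff, hsplit, C_eq, A_eq, Z₁₁, ← map_transpose', ← map_mul', ← map_mul', ← map_add',
      ← map_mul', ← map_transpose', ← map_mul', Matrix.map_apply, QQ]

/-- **(D2)** at the witness slopes. -/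
theorem sectorCoeff_nonneg (k : Fin 3 × Fin 3) :
    0 ≤ dualSectorCoeff WSCC9.lurieSystem Z₁₁ Z₂₁ Z₂₂ a0 b0 k := by
  obtain ⟨hU, hV, hW, -, -⟩ := functionals_eq k
  rw [dualSectorCoeff, hU, hV, hW, a0, b0]
  exact_mod_cast (lpDual_tests k).1

/-- **(D3′)** on every channel: `a0_k · q_k ≤ 2 s_k`. -/
theorem lowerPopovCoeff_le (k : Fin 3 × Fin 3) :
    a0 k * dualLowerCoeff WSCC9.lurieSystem Z₁₁ Z₂₁ k ≤ 2 * dualPopovCoeff WSCC9.lurieSystem Z₂₁ Z₂₂ k := by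
  obtain ⟨-, -, -, hS, hQ⟩ := functionals_eq k
  rw [hS, hQ, a0]
  exact_mod_cast (lpDual_tests k).2.1

/-- **(D4a)** `a0 < b0`. -/
theorem slope_lt (k : Fin 3 × Fin 3) : a0 k < b0 k := by
  unfold a0 b0; exact_mod_cast (lpDual_tests k).2.2.1

/-- **(D4b)** `tr Z₁₁ > 0`. -/
theorem trace_pos : 0 < Matrix.trace Z₁₁ := by
  have h : Matrix.trace Z₁₁ = ((Matrix.trace Z11Q : ℚ) : ℝ) := by
    simp [Z₁₁, Matrix.trace, Rat.cast_sum]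
  rw [h]; exact_mod_cast trace_test

/-- **THE LP DUAL WITNESS** against the Lur'e–Postnikov POSITIVITY certificate class on
`M′ = WSCC9.lurieSystem` at the inner slopes `(a0, b0)` of the window `γ₀ = 2·arctan(67/1000)`.
[cite: BoydVandenberghe2004, §5.9.4 (5.97)–(5.98), Example 5.14; Khalil2002, §7.1 Example 7.5] -/
def D : LPSlabDualWitness WSCC9.lurieSystem a0 b0 where
  Z₁₁ := Z₁₁
  Z₂₁ := Z₂₁
  Z₂₂ := Z₂₂
  psd := psd
  adjP_psd := adjP_psd
  sectorCoeff_nonneg := sectorCoeff_nonneg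
  lowerPopovCoeff_le := lowerPopovCoeff_le
  slope_lt := slope_lt
  trace_pos := trace_pos

/-- The weightless diagonal channels are NULL for the LP witness (five vanishing functionals). -/
theorem isNull_diag (k : Fin 3 × Fin 3) (hk : k.1 = k.2) : D.IsNull k := by
  obtain ⟨hU, hV, hW, hS, hQ⟩ := functionals_eq k
  obtain ⟨h1, h2, h3, h4, h5⟩ := (lpDual_tests k).2.2.2 hk
  refine ⟨⟨?_, ?_, ?_, ?_⟩, ?_⟩
  · show (WSCC9.lurieSystem.C * Z₁₁ * WSCC9.lurieSystem.Cᵀ) k k = 0; rw [hU]; exact_mod_cast h1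
  · show (Z₂₁ * WSCC9.lurieSystem.Cᵀ) k k = 0; rw [hV]; exact_mod_cast h2
  · show Z₂₂ k k = 0; rw [hW]; exact_mod_cast h3
  · show dualPopovCoeff WSCC9.lurieSystem Z₂₁ Z₂₂ k = 0; rw [hS]; exact_mod_cast h4
  · show dualLowerCoeff WSCC9.lurieSystem Z₁₁ Z₂₁ k = 0; rw [hQ]; exact_mod_cast h5

/-! ### The window points of the active channels (lane V's exact channel data, by name) -/

/-- **`hwin`**: every channel is NULL or has window points `ξa`, `ξb` in `|ξ − δ*_k| ≤ γ₀` with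
`cos ξa ≤ a0_k`, `b0_k ≤ cos ξb` (the inner roundings decided in `window_tests`). -/
theorem hwin : ∀ k, D.IsNull k ∨
    ((∃ ξ, |ξ - WSCC9.lurieSystem.δs k| ≤ γ₀ ∧ Real.cos ξ ≤ a0 k) ∧
      ∃ ξ, |ξ - WSCC9.lurieSystem.δs k| ≤ γ₀ ∧ b0 k ≤ Real.cos ξ) := by
  intro k
  by_cases hk : k.1 = k.2
  · exact Or.inl (isNull_diag k hk)
  right
  obtain ⟨ha0, hlo, hhi⟩ := window_tests k hk
  have hE := WSCC9.postB_SPdamp_eqData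
  have hB : 0 < WSCC9.postB_SPdamp.toModel.B k.1 k.2 :=
    WSCC9.postB_SPdamp.toModel_B_pos WSCC9.postB_SPdamp_B_pos k.1 k.2 hk
  have hY : 0 < WSCC9.postB_SPdamp.toModel.Ypol k.1 k.2 := WSCC9.postB_SPdamp.toModel.Ypol_pos hB
  have hm : WSCC9.postB_SPdamp.toModel.Ypol k.1 k.2 *
      Real.cos (WSCC9.postB_SPdamp.angleOf k.1 - WSCC9.postB_SPdamp.angleOf k.2
        + WSCC9.postB_SPdamp.toModel.θpol k.1 k.2)
        = ((WSCC9.postB_SPdamp.dirMarginB k.1 k.2 : ℚ) : ℝ) := by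
    rw [WSCC9.postB_SPdamp.toModel.Ypol_mul_cos_add hB, WSCC9.postB_SPdamp.dirMarginB_cast hE]
  have hn : WSCC9.postB_SPdamp.toModel.Ypol k.1 k.2 *
      Real.sin (WSCC9.postB_SPdamp.angleOf k.1 - WSCC9.postB_SPdamp.angleOf k.2
        + WSCC9.postB_SPdamp.toModel.θpol k.1 k.2)
        = ((WSCC9.postB_SPdamp.dirSinB k.1 k.2 : ℚ) : ℝ) := by
    rw [WSCC9.postB_SPdamp.toModel.Ypol_mul_sin_add hB, WSCC9.postB_SPdamp.dirSinB_cast hE]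
  have hδ := WSCC9.postB_SPdamp_channelShift_abs_lt k
  have hY2 : WSCC9.postB_SPdamp.toModel.Ypol k.1 k.2 ^ 2 = ((WSCC9.postB_SPdamp.Ysq k.1 k.2 : ℚ) : ℝ) :=
    WSCC9.postB_SPdamp.Ypol_sq_cast k.1 k.2
  have hδs : WSCC9.lurieSystem.δs k
      = WSCC9.postB_SPdamp.angleOf k.1 - WSCC9.postB_SPdamp.angleOf k.2
        + WSCC9.postB_SPdamp.toModel.θpol k.1 k.2 := rfl
  rw [hδs]
  constructor
  · refine exists_window_point_cos_le (a₀ := a0 k) hY hm hn cos_γ₀_cast sin_γ₀_cast γ₀_range.1 ?_ ?_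
    · unfold a0; exact_mod_cast ha0
    · rcases hlo with h | h
      · left; exact_mod_cast h
      · right; unfold a0; rw [hY2]; exact_mod_cast h
  · refine exists_window_point_le_cos (b₀ := b0 k) hY hm hn cos_γ₀_cast sin_γ₀_cast γ₀_range.1 ?_
    rcases hhi with ⟨h1, h2, h3⟩ | ⟨h4, h5⟩
    · left
      refine ⟨by unfold b0; exact_mod_cast h1, ?_, by linarith [γ₀_range.2, Real.pi_pos],
        by exact_mod_cast h2, by rw [hY2]; exact_mod_cast h3⟩
      have : |InternalNode.channelShift WSCC9.postB_SPdamp.toModel.θpol WSCC9.postB_SPdamp.angleOf k|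
          = |WSCC9.postB_SPdamp.angleOf k.1 - WSCC9.postB_SPdamp.angleOf k.2
              + WSCC9.postB_SPdamp.toModel.θpol k.1 k.2| := rfl
      linarith [hδ, Real.pi_pos]
    · right
      refine ⟨by exact_mod_cast h4, ?_⟩
      rcases h5 with h | h
      · left; unfold b0; exact_mod_cast h
      · right; unfold b0; rw [hY2]; exact_mod_cast h

/-! ### THE THEOREM -/

/-- **No Lur'e–Postnikov POSITIVITY certificate at the window `γ₀`.**  No
`Λ : LPSlabCertificate WSCC9.lurieSystem` (coercivity `P + Cᵀ·diag(λa)·C ⪰ ε·1`, `P` free) satisfies the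
sector hypothesis of lit-6's LP ROA theorem (`LPSlabCertificate.well_subset_regionOfAttraction`) on the
window `|ξ − δ*_k| ≤ γ₀ = 2·arctan(67/1000)`: the LP dual witness `D` refutes it (weak theorem of
alternatives).  CERTIFIED sentence: the WIDER typed certificate class is EMPTY at `γ₀` — a statement about
certificates, not about trajectories of `M′`.
[cite: BoydVandenberghe2004, §5.9.4 (5.97)–(5.98), Example 5.14; Khalil2002, §7.1 Example 7.5] -/
theorem no_lpSlabCertificate_at (Λ : LPSlabCertificate WSCC9.lurieSystem)
    (hsec : ∀ k ξ, |ξ - WSCC9.lurieSystem.δs k| ≤ 2 * Real.arctan (67 / 1000) →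
      Λ.a k ≤ Real.cos ξ ∧ Real.cos ξ ≤ Λ.b k) :
    False := by
  rw [← γ₀_eq] at hsec
  exact Λ.false_of_lpDualWitness_of_exists_window D (γ := fun _ => γ₀) hsec hwin

/-- **No positivity certificate at any window `γ ≥ γ₀`** (the sector hypothesis for `γ` implies it for `γ₀`). -/
theorem no_lpSlabCertificate (Λ : LPSlabCertificate WSCC9.lurieSystem) {γ : ℝ}
    (hγ : 2 * Real.arctan (67 / 1000) ≤ γ)
    (hsec : ∀ k ξ, |ξ - WSCC9.lurieSystem.δs k| ≤ γ → Λ.a k ≤ Real.cos ξ ∧ Real.cos ξ ≤ Λ.b k) :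
    False :=
  no_lpSlabCertificate_at Λ fun k ξ hξ => hsec k ξ (hξ.trans hγ)

/-- **The positivity class is empty from `γ₀` on** (set form): for every `γ ≥ 2·arctan(67/1000)` there is
NO `LPSlabCertificate` usable on the window `γ`. -/
theorem lpSlabClass_empty (γ : ℝ) (hγ : 2 * Real.arctan (67 / 1000) ≤ γ) :
    ¬ ∃ Λ : LPSlabCertificate WSCC9.lurieSystem,
      ∀ k ξ, |ξ - WSCC9.lurieSystem.δs k| ≤ γ → Λ.a k ≤ Real.cos ξ ∧ Real.cos ξ ≤ Λ.b k :=
  fun ⟨Λ, hsec⟩ => no_lpSlabCertificate Λ hγ hsec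

/-- **Per-channel windows**: the refutation needs the window only on the six ACTIVE channels and only
`γ_k ≥ γ₀` there — for every window function `γ` with `γ₀ ≤ γ_k` on the channels `p ≠ q` (anything on
the weightless diagonal channels), no positivity certificate satisfies the sector hypothesis. -/
theorem no_lpSlabCertificate_perChannel (Λ : LPSlabCertificate WSCC9.lurieSystem) (γ : Fin 3 × Fin 3 → ℝ)
    (hγ : ∀ k : Fin 3 × Fin 3, k.1 ≠ k.2 → 2 * Real.arctan (67 / 1000) ≤ γ k)
    (hsec : ∀ k ξ, |ξ - WSCC9.lurieSystem.δs k| ≤ γ k → Λ.a k ≤ Real.cos ξ ∧ Real.cos ξ ≤ Λ.b k) :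
    False := by
  simp only [← γ₀_eq] at hγ
  refine Λ.false_of_lpDualWitness_of_exists_window D (γ := γ) hsec fun k => ?_
  by_cases hk : k.1 = k.2
  · exact Or.inl (isNull_diag k hk)
  · rcases hwin k with h | ⟨⟨ξa, hξa, hca⟩, ξb, hξb, hcb⟩
    · exact Or.inl h
    · exact Or.inr ⟨⟨ξa, hξa.trans (hγ k hk), hca⟩, ξb, hξb.trans (hγ k hk), hcb⟩

/-- **The class of record from the LP witness** (special case by `toSlabDualWitness`): no
`Λ : SlabCertificate WSCC9.lurieSystem` satisfies the sector hypothesis for any window `≥ 2·arctan(67/1000)`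
either — ONE witness now refutes both typed classes at this window. -/
theorem no_slabCertificate_of_lp (Λ : SlabCertificate WSCC9.lurieSystem) {γ : ℝ}
    (hγ : 2 * Real.arctan (67 / 1000) ≤ γ)
    (hsec : ∀ k ξ, |ξ - WSCC9.lurieSystem.δs k| ≤ γ → Λ.a k ≤ Real.cos ξ ∧ Real.cos ξ ≤ Λ.b k) :
    False :=
  no_lpSlabCertificate Λ.toLP hγ hsec

/-- **THE LP BRACKET** (one kernel object for the row's sentence): the POSITIVITY class is NON-EMPTY at
★ #35's window `2·arctan(13/200)` (lane V's `cert.toLP` with its `hsec`, `WSCC9LossySlabRoa`) and EMPTY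
at every window `≥ 2·arctan(67/1000)` (this file). -/
theorem lpClassCeiling_bracket :
    (∃ Λ : LPSlabCertificate WSCC9.lurieSystem,
      ∀ k ξ, |ξ - WSCC9.lurieSystem.δs k| ≤ 2 * Real.arctan (13 / 200) →
        Λ.a k ≤ Real.cos ξ ∧ Real.cos ξ ≤ Λ.b k) ∧
    ∀ γ' : ℝ, 2 * Real.arctan (67 / 1000) ≤ γ' → ¬ ∃ Λ : LPSlabCertificate WSCC9.lurieSystem,
      ∀ k ξ, |ξ - WSCC9.lurieSystem.δs k| ≤ γ' → Λ.a k ≤ Real.cos ξ ∧ Real.cos ξ ≤ Λ.b k := by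
  refine ⟨⟨WSCC9LossySlab.cert.toLP, ?_⟩, lpSlabClass_empty⟩
  have hγ : WSCC9LossySlab.γ = 2 * Real.arctan (13 / 200) := by
    unfold WSCC9LossySlab.γ; norm_num [uQ]
  rw [← hγ]
  exact WSCC9LossySlab.hsec

/-- This window lies ABOVE «#74′»'s: `2·arctan(33/500) < 2·arctan(67/1000)` (the positivity class is
refuted from 7.666°; the class of record already from 7.552° by B's witness). -/
theorem γ₀_dual33_lt_γ₀ : WSCC9LossySlabDual33.γ₀ < γ₀ := by
  unfold WSCC9LossySlabDual33.γ₀ γ₀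
  have h : ((WSCC9LossySlabDual33.u0Q : ℚ) : ℝ) < ((u0Q : ℚ) : ℝ) := by
    norm_num [u0Q, WSCC9LossySlabDual33.u0Q]
  have := Real.arctan_strictMono h
  linarith

/-- This window lies strictly BELOW ★ #74's `2·arctan(7/100)` (so #74's `slabClass_empty` is a special
case of this file's `no_slabCertificate_of_lp`, now for BOTH classes). -/
theorem γ₀_lt_dual74 : γ₀ < WSCC9LossySlabDual.γ₀ := by
  unfold γ₀ WSCC9LossySlabDual.γ₀
  have h : ((u0Q : ℚ) : ℝ) < ((WSCC9LossySlabDual.u0Q : ℚ) : ℝ) := by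
    norm_num [u0Q, WSCC9LossySlabDual.u0Q]
  have := Real.arctan_strictMono h
  linarith

end Summit.Ventures.GridStability.Lyapunov.WSCC9LossySlabLPDual

end
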